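import Summits.BirchSwinnertonDyer.BirchSwinnertonDyer.Theorems.KolyvaginRoadThreeCruxIffLeafAnyDiscr
import Summits.BirchSwinnertonDyer.BirchSwinnertonDyer.Theorems.KolyvaginRoadThreePairConsumer
import Summits.BirchSwinnertonDyer.Rank1Residual.X2.RankOneDescentConverse
import HarnessLib

/-!
# Route `KolyvaginRoadThree`, deciding crux `ZhangSharpFrameAtThreeHL` (item stmt-BirchSwinnertonDyer-19574): the
# per-pair consumer and LEMMA V at ANY Heegner frame (`d_K` odd or even) — corollaries completing the any-parity set
# (cell `bsd-stepL`, seat `bsd-stepL-zhang3-p1` g3; `--supports stmt-BirchSwinnertonDyer-19574`, helper)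

THEOREMS ONLY (no definition, no named fact, no `sorry`); `BSDp W 3` ∕ the certificate are HYPOTHESES; published inputs
are named facts of the tree taken as binders; Barrios et al. 2025 enters as a DISCHARGED tree theorem (harvest-2's
`O5.TwistTamagawa.padicValNat_tamagawaProduct_twist_of_heegner_three`). PARTITION: O2@3 (B10) × A1 (1 116 TRUE-OPEN;
cw 248 943) ∪ (T2′)@3 (tightness) — types-the-object-of; closes: none.

* `Koly.bsdp_three_of_not_pDiv_at_heegnerFrame` — `KolyvaginRoadThreePairConsumer`'s consumer (p433031) with `Odd d_K`
  DELETED: ONE non-3-divisible derived Heegner point `P(n)` at ONE Manin-good conductor-1 frame of ANY Heegner field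
  with `L(E^{d_K},1) ≠ 0` of an A1 curve ⟹ `BSDp W 3`;
* `Koly.kolyvaginClass_one_eq_zero_of_bsdp_of_dvd_tamagawa_anyDiscr` — LEMMA V (`KolyvaginRoadThreeTamagawaVanishing`,
  p432696) with `Odd d_K` DELETED: granted `BSDp W 3`, every mod-3 Kolyvagin class vanishes at every such frame of an
  X11b@3 ∧ (ram) curve with `3 ∣ ∏c`;
* `Koly.exists_kolyvaginClass_one_ne_zero_iff_not_dvd_tamagawa_of_bsdp_anyDiscr` — the dichotomy at any such frame.

References (locators only): [cite: BarriosEtAl2025, Thm. 5.1] [cite: WZhang2014, Thm. 1.1, Remark 5, Thm. 10.2]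
[cite: McCallumLMS1991, §4 Cor. 4.5, §5 Lemma 5.1 and Cor. 5.6] [cite: GrossLMS1991, §3, §4 (4.1)] [cite: Jetchev2008, §1 (1)].
-/

noncomputable section

open scoped Classical

namespace Summit.BirchSwinnertonDyer.Rank1Residual.X11b.Three.Koly

open WeierstrassCurve NumberField Literature.NumberTheory.EllipticCurves
  Literature.NumberTheory.EllipticCurves.ModularForms
  Literature.NumberTheory.EllipticCurves.Rank1Residual
  Summit.BirchSwinnertonDyer.Rank1Residual Summit.BirchSwinnertonDyer.Rank1Residual.X11b

/-- **PER-PAIR CONSUMER at ANY Heegner frame with `L(E^{d_K},1) ≠ 0`**: one Kolyvagin–Heegner datum `d` at a level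
`n ∈ Λ₃` with `P(n) ∉ 3·E(K[n])` (`¬ PDiv d 3 1`, the statement a computation certifies) ⟹ `BSDp W 3`, for an A1 curve
and ANY imaginary quadratic Heegner `K` (d_K odd or even), Manin-good frame. Tower below `d` from Gross 1991 §3, class
from g0's tower theorem, then `Koly.bsdp_three_of_kolyvaginClass_one_ne_zero_at_heegnerFrame` (p435143). CONDITIONAL on
every binder; nothing asserted about any curve. [cite: McCallumLMS1991, §4 Cor. 4.5 and §5 Cor. 5.6] [cite: BarriosEtAl2025, Thm. 5.1] -/
theorem bsdp_three_of_not_pDiv_at_heegnerFrame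
    (W : WeierstrassCurve ℚ) [W.IsElliptic] [W.IsGloballyMinimal] [NeZero (W.conductorNorm ℤ)]
    (K : Type) [Field K] [NumberField K]
    (Dt : ModularParametrizationData W (W.conductorNorm ℤ)) (β : ℤ) (ι : K →+* ℂ)
    (hGZ : gross_zagier (W.conductorNorm ℤ) W K) (hKo : kolyvagin (W.conductorNorm ℤ) W K)
    (hB : Kolyvagin1990_padicValNat_card_sha_le (W.conductorNorm ℤ) W K)
    (hSk : Skinner2016.thmC_padicValRat_bsd_rank_zero)
    (hGZK : rank_eq_analyticRank_of_analyticRank_le_one) (hmod : hasEntireLFunction_rat)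
    (hrec : heegnerPointOfConductor_one_galoisConj (W.conductorNorm ℤ) W K)
    (h1 : phi_heegnerPointOfConductor_mem_range_map_ringClassField (W.conductorNorm ℤ) W K)
    (h2 : exists_generator_ringClassGalOver K)
    (hMc : McCallum1991_pow_dvd_card_sha_primary_of_certificate)
    (hX : ClassX11b W 3) (hram : Ram W 3) (htam : ¬ 3 ∣ W.tamagawaProduct)
    (hK : IsImaginaryQuadratic K) (hH : SatisfiesHeegnerHypothesis (W.conductorNorm ℤ) K)
    (hLt : (W.quadraticTwist (NumberField.discr K : ℚ)).entireLFunction 1 ≠ 0) (hc : ¬ (3 : ℤ) ∣ Dt.c)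
    {n : ℕ} (hn : KolyvaginDescent.KolSupp (Zhang2014.IsKolyvaginPrime (W.conductorNorm ℤ) W K 3) n)
    (d : KolyvaginHeegnerData Dt β ι n) (hcert : ¬ PDiv d 3 1) :
    BSDp W 3 := by
  have hmult : W.HasMultiplicativeReductionAtPrime 3 := hX.2.2.1
  have hρ : Surj W 3 := surj_of_irr_of_ram W 3 hX.2.2.2 hram
  have hβ : (4 * (W.conductorNorm ℤ : ℤ)) ∣ β ^ 2 - NumberField.discr K := d.dvd_sq_sub
  have hinert : ∀ m : ℕ, m ∣ n → ∀ q ∈ m.primeFactors, (Ideal.span {(q : 𝓞 K)}).IsPrime :=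
    fun m hm q hq ↦ (hn.2 q (Nat.primeFactors_mono hm hn.1.ne_zero hq)).2.2.2.2.1
  have hKD : ∀ m : ℕ, m ∣ n → Nonempty (KolyvaginHeegnerData Dt β ι m) := fun m hm ↦
    Summit.BirchSwinnertonDyer.BirchSwinnertonDyer.Theorems.nonempty_kolyvaginHeegnerData_of_grossCM h1 h2 hK hH
      Dt β ι hβ (hn.1.squarefree_of_dvd hm) (hinert m hm)
  let dd : (m : ℕ) → m ∣ n → KolyvaginHeegnerData Dt β ι m := fun m hm ↦
    if h : m = n then h ▸ d else Classical.choice (hKD m hm)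
  have hdd : dd n dvd_rfl = d := by
    show (if h : n = n then h ▸ d else _) = d
    rw [dif_pos rfl]
  have hcert' : ¬ PDiv (dd n dvd_rfl) 3 1 := by rwa [hdd]
  have hne := KolyCert.kolyvaginClass_three_ne_zero_of_tower_not_pDiv W K Dt β ι hmult hρ hK hH hn dd hcert'
  rw [hdd] at hne
  exact bsdp_three_of_kolyvaginClass_one_ne_zero_at_heegnerFrame W K Dt β ι hGZ hKo hB hSk hGZK hmod hrec h1 h2 hMc
    hX hram htam hK hH hLt hβ hc d hn hne

/-- **LEMMA V at ANY Heegner frame with `L(E^{d_K},1) ≠ 0`** (`kolyvaginClass_one_eq_zero_of_bsdp_of_dvd_tamagawa`,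
p432696, with `Odd d_K` DELETED): granted `BSDp W 3`, EVERY mod-3 Kolyvagin class of an X11b@3 ∧ (ram) curve with
`3 ∣ ∏ c_ℓ` vanishes at every Manin-good conductor-1 frame of every Heegner field with `L(E^{d_K},1) ≠ 0`. The
identity over `K` from `BSD(E,3)` is eisenstein-p2's `X2.indexIdentityAt_of_bsdp` with the ANY-`d_K` Tamagawa
transport at `3`; the certificate bound is McCallum's. CONDITIONAL on every binder; nothing is booked.
[cite: WZhang2014, Thm. 1.1 and Thm. 10.2] [cite: Jetchev2008, §1 (1)] [cite: McCallumLMS1991, §5 Cor. 5.6] [cite: BarriosEtAl2025, Thm. 5.1] -/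
theorem kolyvaginClass_one_eq_zero_of_bsdp_of_dvd_tamagawa_anyDiscr
    (W : WeierstrassCurve ℚ) [W.IsElliptic] [W.IsGloballyMinimal] [NeZero (W.conductorNorm ℤ)]
    (K : Type) [Field K] [NumberField K]
    (Dt : ModularParametrizationData W (W.conductorNorm ℤ)) (β : ℤ) (ι : K →+* ℂ)
    (hGZ : gross_zagier (W.conductorNorm ℤ) W K) (hKo : kolyvagin (W.conductorNorm ℤ) W K)
    (hSk : Skinner2016.thmC_padicValRat_bsd_rank_zero)
    (hGZK : rank_eq_analyticRank_of_analyticRank_le_one) (hmod : hasEntireLFunction_rat)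
    (hrec : heegnerPointOfConductor_one_galoisConj (W.conductorNorm ℤ) W K)
    (h1 : phi_heegnerPointOfConductor_mem_range_map_ringClassField (W.conductorNorm ℤ) W K)
    (h2 : exists_generator_ringClassGalOver K)
    (hMc : McCallum1991_pow_dvd_card_sha_primary_of_certificate)
    (hX : ClassX11b W 3) (hram : Ram W 3) (htam : 3 ∣ W.tamagawaProduct)
    (hK : IsImaginaryQuadratic K) (hH : SatisfiesHeegnerHypothesis (W.conductorNorm ℤ) K)
    (hLt : (W.quadraticTwist (NumberField.discr K : ℚ)).entireLFunction 1 ≠ 0)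
    (hβ : (4 * (W.conductorNorm ℤ : ℤ)) ∣ β ^ 2 - NumberField.discr K) (hc : ¬ (3 : ℤ) ∣ Dt.c)
    (hbsd : BSDp W 3)
    {n : ℕ} (d : KolyvaginHeegnerData Dt β ι n)
    (hn : KolyvaginDescent.KolSupp (Zhang2014.IsKolyvaginPrime (W.conductorNorm ℤ) W K 3) n) :
    d.kolyvaginClass Nat.prime_three 1 = 0 := by
  haveI : Fact (Nat.Prime 3) := ⟨Nat.prime_three⟩
  by_contra hne
  have hmult : W.HasMultiplicativeReductionAtPrime 3 := hX.2.2.1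
  have hirr : Irr W 3 := hX.2.2.2
  have hρ : Surj W 3 := surj_of_irr_of_ram W 3 hirr hram
  have hsurj : ∀ m : ℕ, W.HasSurjectiveModNGaloisRep (3 ^ m : ℕ) :=
    Rank1Residual.surjective_pow_three_of_mult_of_tateLine W hmult hρ
  have hCM : ¬ W.HasCM := not_hasCM_of_hasMultiplicativeReductionAtPrime' W hmult
  obtain ⟨h3d, hμ⟩ := not_dvd_discr_and_not_dvd_torsionOrder_of_heegner hK hH (p := 3) (by decide)
    (dvd_conductorNorm_of_classX11b hX)
  have hND : IsCoprime (W.conductorNorm ℤ : ℤ) (NumberField.discr K) := by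
    have h := Literature.SatisfiesHeegnerHypothesis.coprime_discr hK.1 hH
    refine Int.isCoprime_iff_gcd_eq_one.mpr ?_
    rw [Int.gcd_eq_natAbs, Int.natAbs_natCast]
    exact h
  have hlt := discr_lt_neg_four_of_isCoprime_of_dvd_sq_sub hK hND (dvd_conductorNorm_of_classX11b hX) hβ
  have h3 : NumberField.discr K ≠ -3 := by omega
  have h4 : NumberField.discr K ≠ -4 := by omega
  have hDneg : NumberField.discr K < 0 := by omega
  obtain ⟨H, hHβ⟩ := exists_heegnerDatum (W.conductorNorm ℤ) hDneg hβ
  obtain ⟨P, hP⟩ := heegnerPointComplex_mem_range_map_holds (W.conductorNorm ℤ) W K hK hH Dt H ι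
  have hD0 : (NumberField.discr K : ℚ) ≠ 0 := by exact_mod_cast NumberField.discr_ne_zero K
  haveI hEt : (W.quadraticTwist (NumberField.discr K : ℚ)).IsElliptic := W.isElliptic_quadraticTwist hD0
  obtain ⟨Cd, hCd⟩ := hasGlobalMinimalModel_rat_holds (W.quadraticTwist (NumberField.discr K : ℚ))
  haveI := hCd
  set Wd := Cd • W.quadraticTwist (NumberField.discr K : ℚ) with hWd_def
  have hWd : Cd • W.quadraticTwist (NumberField.discr K : ℚ) = Wd := rfl
  have hmultd : Wd.HasMultiplicativeReductionAtPrime 3 :=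
    hasMultiplicativeReductionAtPrime_twist_of_heegner' W 3 K hK hH hmult Cd hWd
  have hirrd : Wd.HasIrreducibleModPGaloisRep 3 := hasIrreducibleModPGaloisRep_twist_model W 3 K hK.1 hirr Cd hWd
  have hramd : Ram Wd 3 := ram_twist_of_heegner W 3 K hK hH hram Cd hWd
  have htamd : padicValNat 3 Wd.tamagawaProduct = padicValNat 3 W.tamagawaProduct :=
    O5.TwistTamagawa.padicValNat_tamagawaProduct_twist_of_heegner_three W Wd K hK hH h3d Cd hWd
  have hu : padicValRat 3 (Cd.u : ℚ) = 0 := padicValRat_u_eq_zero_of_twist_minimal W 3 K hK hH hmult Cd hWd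
  have hLt' : (W.quadraticTwist (NumberField.discr K : ℚ)).entireLFunction = Wd.entireLFunction := by
    rw [← hWd, entireLFunction_smul]
  have hLd1 : Wd.entireLFunction 1 ≠ 0 := by rw [← hLt']; exact hLt
  have hrd : Wd.analyticRank = 0 := (Wd.analyticRank_eq_zero_iff_holds (hmod Wd)).2 hLd1
  have hfinSd : Finite Wd.sha := (hGZK Wd (by omega)).2
  obtain ⟨qd, hqd, hvqd⟩ := hSk Wd 3 le_rfl (Or.inr hmultd) hirrd hramd hLd1 hfinSd
  have hid : IndexIdentityAt W 3 K P :=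
    X2.indexIdentityAt_of_bsdp W 3 (W.conductorNorm ℤ) K Dt H ι P hGZ hKo hGZK hmod hK hH hP (by decide)
      (by exact_mod_cast hc) hμ hX.1 hLt Wd Cd hWd ⟨qd, hqd, hvqd⟩ htamd hu hbsd
  have hPinf : ¬ IsOfFinAddOrder P :=
    not_isOfFinAddOrder_of_heegner_of_analyticRank_eq_one W (W.conductorNorm ℤ) K Dt H ι P hGZ hmod hX.1 hK hH
      hLt hP
  obtain ⟨hrank, hSha⟩ := hKo hK hH ⟨Dt, H, ι, hP⟩ hPinf
  haveI : Finite (W.baseChange K).sha := hSha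
  have hbot := torsionBy_eq_bot_of_isImaginaryQuadratic_of_hasIrreducibleModPGaloisRep W K hK Nat.prime_three hirr
  have hiv : ∀ x : (W.baseChange K).toAffine.Point, 3 • x = 0 → x = 0 := fun x hx ↦ by
    have hmem : x ∈ AddSubgroup.torsionBy (W.baseChange K).toAffine.Point ((3 : ℕ) : ℤ) := by
      rw [mem_torsionBy_iff, natCast_zsmul]
      exact hx
    rw [hbot] at hmem
    exact hmem
  haveI : Module.Finite ℤ (W.baseChange K).toAffine.Point := (W.baseChange K).module_finite_point_holds
  obtain ⟨M₀, x₀, hx₀, hmax⟩ := exists_pow_smul_eq_and_forall_ne hPinf (p := 3) (by norm_num)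
  have hdiv : ∃ Q : (W.baseChange K).toAffine.Point, ((3 ^ M₀ : ℕ) : ℤ) • Q = P :=
    ⟨x₀, by rw [natCast_zsmul]; exact hx₀⟩
  have hndiv : ¬ ∃ Q : (W.baseChange K).toAffine.Point, ((3 ^ (M₀ + 1) : ℕ) : ℤ) • Q = P := by
    rintro ⟨Q, hQ⟩
    exact hmax Q (by rw [← natCast_zsmul]; exact hQ)
  obtain ⟨d₁⟩ := Summit.BirchSwinnertonDyer.BirchSwinnertonDyer.Theorems.nonempty_kolyvaginHeegnerData_of_grossCM
    h1 h2 hK hH Dt β ι hβ squarefree_one (by simp)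
  have hPd : d₁.toGeomPoints d₁.derivedPoint = toGeomPoints (W.baseChange K) P :=
    KolyvaginBottom.toGeomPoints_derivedPoint_one_eq hrec hK hH hP d₁ hHβ
  haveI : Finite (AddCommGroup.torsion (W.baseChange K).toAffine.Point) :=
    WeierstrassCurve.finite_torsion_point (W := W.baseChange K)
  obtain ⟨cc, Q, hcQ, hcker⟩ := RankOne.exists_coord_of_mordellWeilRank_eq_one (W.baseChange K) hrank
  have hidx : padicValNat 3 (AddSubgroup.zmultiples P).index = M₀ :=
    padicValNat_index_zmultiples_eq_of_divisibility cc Q hcQ hcker hiv P hdiv hndiv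
  have hsha : padicValNat 3 (W.baseChange K).shaOrder =
      padicValNat 3 (Nat.card (AddCommGroup.primaryComponent (W.baseChange K).sha 3)) :=
    padicValNat_shaOrder_eq (W.baseChange K) 3
  have hℓ : ∀ ℓ ∈ n.primeFactors, Zhang2014.IsKolyvaginPrime (W.conductorNorm ℤ) W K 3 ℓ ∧
      0 + 1 ≤ Zhang2014.kolyvaginIndex W 3 ℓ :=
    fun ℓ hℓ ↦ ⟨hn.2 ℓ hℓ, (hn.2 ℓ hℓ).2.2.2.2.2⟩
  have hcert : ¬ ∃ Q : (W.baseChange (ringClassField K ι n)).toAffine.Point,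
      ((3 ^ (0 + 1) : ℕ) : ℤ) • Q = d.derivedPoint :=
    not_pDiv_of_kolyvaginClass_ne_zero d hne
  have hle := two_mul_sub_le_padicValNat_card_sha_primary_of_certificate hMc W hCM K hK h3 h4 hH 3 (by norm_num)
    hsurj Dt β ι d₁ P hPd hPinf hdiv hndiv d hn.1 hℓ hcert
  have htam1 : 1 ≤ padicValNat 3 W.tamagawaProduct :=
    one_le_padicValNat_of_dvd (W.tamagawaProduct_pos_holds).ne' htam
  unfold IndexIdentityAt at hid
  rw [hidx, hsha] at hid
  omega

/-- **The dichotomy at ANY Heegner frame with `L(E^{d_K},1) ≠ 0`, granted `BSD(E,3)`** (`exists_kolyvaginClass_one_ne_zero_iff_not_dvd_tamagawa_of_bsdp`,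
p432696, with `Odd d_K` DELETED): an X11b@3 ∧ (ram) curve with `BSDp W 3` carries a non-zero mod-3 Kolyvagin class at
the frame iff `3 ∤ ∏ c_ℓ`. CONDITIONAL on every binder; nothing is booked. [cite: WZhang2014, Thm. 1.1 and Thm. 10.2]
[cite: Jetchev2008, §1 (1)] [cite: McCallumLMS1991, §5 Cor. 5.6] [cite: BarriosEtAl2025, Thm. 5.1] -/
theorem exists_kolyvaginClass_one_ne_zero_iff_not_dvd_tamagawa_of_bsdp_anyDiscr
    (W : WeierstrassCurve ℚ) [W.IsElliptic] [W.IsGloballyMinimal] [NeZero (W.conductorNorm ℤ)]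
    (K : Type) [Field K] [NumberField K]
    (Dt : ModularParametrizationData W (W.conductorNorm ℤ)) (β : ℤ) (ι : K →+* ℂ)
    (hGZ : gross_zagier (W.conductorNorm ℤ) W K) (hKo : kolyvagin (W.conductorNorm ℤ) W K)
    (hSk : Skinner2016.thmC_padicValRat_bsd_rank_zero)
    (hGZK : rank_eq_analyticRank_of_analyticRank_le_one) (hmod : hasEntireLFunction_rat)
    (hrec : heegnerPointOfConductor_one_galoisConj (W.conductorNorm ℤ) W K)
    (h1 : phi_heegnerPointOfConductor_mem_range_map_ringClassField (W.conductorNorm ℤ) W K)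
    (h2 : exists_generator_ringClassGalOver K)
    (hMc : McCallum1991_pow_dvd_card_sha_primary_of_certificate)
    (hMcU : McCallum1991_padicValNat_card_sha_primary_add_le_of_globalDivisibility)
    (hX : ClassX11b W 3) (hram : Ram W 3)
    (hK : IsImaginaryQuadratic K) (hH : SatisfiesHeegnerHypothesis (W.conductorNorm ℤ) K)
    (hLt : (W.quadraticTwist (NumberField.discr K : ℚ)).entireLFunction 1 ≠ 0)
    (hβ : (4 * (W.conductorNorm ℤ : ℤ)) ∣ β ^ 2 - NumberField.discr K) (hc : ¬ (3 : ℤ) ∣ Dt.c)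
    (hbsd : BSDp W 3) :
    (∃ (n : ℕ) (d : KolyvaginHeegnerData Dt β ι n),
      KolyvaginDescent.KolSupp (Zhang2014.IsKolyvaginPrime (W.conductorNorm ℤ) W K 3) n ∧
        d.kolyvaginClass Nat.prime_three 1 ≠ 0) ↔ ¬ 3 ∣ W.tamagawaProduct := by
  constructor
  · rintro ⟨n, d, hn, hne⟩ htam
    exact hne (kolyvaginClass_one_eq_zero_of_bsdp_of_dvd_tamagawa_anyDiscr W K Dt β ι hGZ hKo hSk hGZK hmod hrec h1 h2
      hMc hX hram htam hK hH hLt hβ hc hbsd d hn)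
  · intro htam
    exact kolyvaginClass_one_ne_zero_of_bsdp_of_heegnerFrame_three W K Dt β ι hGZ hKo hSk hGZK hmod hrec h1 h2 hMcU hX
      hram htam hK hH hLt hβ hc hbsd

end Summit.BirchSwinnertonDyer.Rank1Residual.X11b.Three.Koly

end
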